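import Summits.ABC.IUTFork.Cor312ThetaLocalBound
import Summits.ABC.IUTFork.Cor312FactorVolumeDilates
import HarnessLib

/-!
# [IUTchIII] Cor. 3.12 — the deep-place fork AT THE GENUINE CONTAINER: the per-packet readings fail at a
# deep packet of a frames setting with real volumes, modulo box-containment, one stability instance, depth

Record-only file (D-0012) of the abc-iut cell (Cor. 3.12 cone, D-0067; TEAM A seat abc-iut-c312-10;
`not_pointwise_real` lane of skel FORK-LOCAL-GLOBAL §6 — the container instantiation of the one-packet
fork `Cor312Vol.not_pointwise_of_deep_packet`); TAKES NO SIDE; theorems only, no new `Prop` fact.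

`Cor312ThetaLocalBound` (p417644) proves the one-packet deep-place fork at ANY frozen setting modulo the
container numerics `hnum : logvol (c • W) ≤ w·qLocal + κ`. THIS FILE discharges `hnum` AS AN EQUALITY at
the settings `Setting.ofFrames … (V.toRealFrames …)` whose volumes are REALISED by frame volume pieces
(genuine Haar / radial factor volumes, c312-6 `FrameVolumePieces`): for the dilate
`W = e⁻¹((λ_q^{N}·c₀)·𝒪_L)` of a hull-set by the `N`-th power of the `q`-pilot centre,
`logvol W = Σᵢ wᵢ·μ̇^log_i(c₀ᵢ) + N·qLocal` (w4-d036 `logvol_preimage_hullSet_pow_mul` at `t := λ_q` +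
c312-6's closed form `qLocal_ofFrames`) — the [IUTchIV] Thm. 1.10 Step (v) SHAPE with `w = N` (print:
`N = j²` at label `j`, p. 28) and `κ = Σᵢ wᵢ·μ̇^log_i(c₀ᵢ)`; membership of `W` in the frame's hull-sets
holds BY CONSTRUCTION of the pulled-back frame. Hence:

* **`not_pointwise_ofFrameVolumes_of_deep`** — at such a setting with the bridge hypotheses, if at ONE
  packet `(labelSucc i₀, v_ℚ⁰)` (i) every (Ind1)/(Ind2)-family maps the dilate preimage onto itself (the
  stability instance — c312-5 p416953 `family_image_latticePk` shape; generator level), (ii) the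
  (Ind3)-enlarged Θ-region lies in the dilate (the box containment — Dupuy–Hilado (4.10) at the
  `q^{j²}`-scale), (iii) the factor log-moduli are multiplicative there (a THEOREM for the genuine
  factors, `ofUltrametric_mulLogvol_mul`/`complexRadial_mulLogvol_mul`), and (iv) the packet is DEEP
  (`κ < (N−1)·(−qLocal)` in closed form — `ord(q)` beyond the XXIVc threshold), then the PER-PACKET
  reading `∀ i v_ℚ, qLocal ≤ thetaLocal` is FALSE.

With this, `not_pointwise_real` (§6: the same at an assembled setting tied to initial Θ-data) is reduced
to exhibiting WITNESS DATA for (i), (ii), (iv) at one bad place of deep initial Θ-data — no abstract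
lemma remains. HONEST SCOPE: (i), (ii), (iv) are NAMED, discharged for no instance here; failure of the
per-packet readings at deep places says NOTHING about the printed GLOBAL inequality (XXIVc
`global_of_compensation` exhibits compensation), and nothing here constrains the intended
Kummer-isomorphism glue — that is the dispute, untouched. [claim: Mochizuki2012, status: disputed]
[cite: DupuyHilado2025, §4.10, §4.12] [cite: ScholzeStix2018, §2.2 pp. 9–10]
-/

noncomputable section

namespace Summit.ABC

namespace IUTFork

namespace Cor312Vol

open Thm311 Cor312 Cor312.Setting Literature.IUT.LogVolume Literature.IUT.LogThetaLattice

open scoped Pointwise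

variable {T : ThetaIndex} {S : Situation T} {V : FrameVolumePieces S.L} {n : ℤ}
  {HT : Type} {LogLink : HT → HT → Type} {IsFull : ∀ {s t : HT}, LogLink s t → Prop}
  (lat : LGPGaussianLogThetaLattice LogLink IsFull)
  {Frd : Type} {IsoF : Frd → Frd → Type} {Ob : Frd → Type} {realify : Frd → Frd} {Strip : Type}
  {IsoS : Strip → Strip → Type} {M : ∀ v : T.V, v ∈ T.Vbad → Type} [∀ v h, Monoid (M v h)]
  (sig : GlobalLGPFrobenioidSignature T.lstar T.V (· ∈ T.Vbad) Frd IsoF Ob realify Strip IsoS M)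
  (split : SplittingMonoids M) {ObΔ : Type} {N : ∀ v : T.V, v ∈ T.Vbad → Type} [∀ v h, Monoid (N v h)]
  (qData : QPilotData ObΔ N)
  (thetaBox : ℤ → Ob sig.Clgp → ∀ j vQ, Set (∀ i, V.K j vQ i))
  (qCentre : ObΔ → ∀ j vQ, ∀ i, V.K j vQ i)
  (hq : ∀ j vQ i, qCentre (qPilotObject qData) j vQ i ≠ 0)
  (hadm : ∀ j vQ (H : Set (∀ i, V.K j vQ i)), Literature.IUT.LogVolume.IsHullSet (V.K j vQ) H →
    (S.D n).Adm j vQ (V.e j vQ ⁻¹' H))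
  (hfin : ∀ j : T.Label, (Function.support fun vQ => (S.D n).logvol j vQ
    (V.e j vQ ⁻¹' Literature.IUT.LogVolume.hullSet (V.K j vQ)
      (qCentre (qPilotObject qData) j vQ))).Finite)

/-- **The deep-place fork at the genuine container** (`hnum` of
`Cor312Vol.not_pointwise_of_deep_packet` DISCHARGED AS AN EQUALITY): at a frames setting with volumes
realised by genuine frame volume pieces, if at one packet the dilate
`e⁻¹((λ_q^{Nw}·c₀)·𝒪_L)` of a hull-set by the `Nw`-th power of the `q`-pilot centre is
(Ind1)/(Ind2)-stable and contains the (Ind3)-enlarged Θ-region, the factor log-moduli are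
multiplicative, and the packet is DEEP (`Σᵢ wᵢ·μ̇^log_i(c₀ᵢ) < (Nw − 1)·(−qLocal)`), then the
PER-PACKET reading fails. [claim: Mochizuki2012, status: disputed]
[cite: DupuyHilado2025, §4.10, §4.12] -/
theorem not_pointwise_ofFrameVolumes_of_deep (hV : V.Realizes (S.D n))
    (H : BridgeHyps (Setting.ofFrames n lat sig split qData (V.toRealFrames thetaBox qCentre) hq hadm hfin))
    (i₀ : Fin T.lstar) (vQ₀ : T.VQ)
    (c₀ : ∀ i, V.K (Setting.labelSucc i₀) vQ₀ i) (hc₀ : ∀ i, c₀ i ≠ 0) (Nw : ℕ)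
    (hmul : ∀ (i : V.J (Setting.labelSucc i₀) vQ₀) (x y : V.K (Setting.labelSucc i₀) vQ₀ i),
      x ≠ 0 → y ≠ 0 → (V.vol (Setting.labelSucc i₀) vQ₀ i).mulLogvol (x * y) =
        (V.vol (Setting.labelSucc i₀) vQ₀ i).mulLogvol x +
          (V.vol (Setting.labelSucc i₀) vQ₀ i).mulLogvol y)
    (hst : ∀ Φ ∈ S.L.Ind1Family ∪ S.L.Ind2Family,
      Φ (Setting.labelSucc i₀) vQ₀ ''
          (V.e (Setting.labelSucc i₀) vQ₀ ⁻¹' Literature.IUT.LogVolume.hullSet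
            (V.K (Setting.labelSucc i₀) vQ₀)
            (fun i => qCentre (qPilotObject qData) (Setting.labelSucc i₀) vQ₀ i ^ Nw * c₀ i)) =
        V.e (Setting.labelSucc i₀) vQ₀ ⁻¹' Literature.IUT.LogVolume.hullSet
          (V.K (Setting.labelSucc i₀) vQ₀)
          (fun i => qCentre (qPilotObject qData) (Setting.labelSucc i₀) vQ₀ i ^ Nw * c₀ i))
    (h3 : (Setting.ofFrames n lat sig split qData (V.toRealFrames thetaBox qCentre) hq hadm
        hfin).thetaRegion3 (Setting.labelSucc i₀) vQ₀ ⊆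
      V.e (Setting.labelSucc i₀) vQ₀ ⁻¹' Literature.IUT.LogVolume.hullSet
        (V.K (Setting.labelSucc i₀) vQ₀)
        (fun i => qCentre (qPilotObject qData) (Setting.labelSucc i₀) vQ₀ i ^ Nw * c₀ i))
    (hdeep : (∑ i, V.w (Setting.labelSucc i₀) vQ₀ i *
        (V.vol (Setting.labelSucc i₀) vQ₀ i).mulLogvol (c₀ i)) <
      ((Nw : ℝ) - 1) * (- (Setting.ofFrames n lat sig split qData (V.toRealFrames thetaBox qCentre) hq
        hadm hfin).qLocal (Setting.labelSucc i₀) vQ₀)) :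
    ¬ ∀ (i' : Fin T.lstar) (vQ' : T.VQ),
        (Setting.ofFrames n lat sig split qData (V.toRealFrames thetaBox qCentre) hq hadm
          hfin).qLocal (Setting.labelSucc i') vQ' ≤
          ((Setting.ofFrames n lat sig split qData (V.toRealFrames thetaBox qCentre) hq hadm
            hfin).thetaLocal (Setting.labelSucc i') vQ').untopD 0 := by
  classical
  set P := Setting.ofFrames n lat sig split qData (V.toRealFrames thetaBox qCentre) hq hadm hfin with hP
  set qc : ∀ i, V.K (Setting.labelSucc i₀) vQ₀ i :=
    qCentre (qPilotObject qData) (Setting.labelSucc i₀) vQ₀ with hqc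
  set W : Set (S.L.Packet (Setting.labelSucc i₀) vQ₀) :=
    V.e (Setting.labelSucc i₀) vQ₀ ⁻¹' Literature.IUT.LogVolume.hullSet
      (V.K (Setting.labelSucc i₀) vQ₀) (fun i => qc i ^ Nw * c₀ i) with hW
  -- the scaled centre is nonzero, so the dilate is a hull-set of the pulled-back frame
  have hctr : ∀ i, qc i ^ Nw * c₀ i ≠ 0 := fun i =>
    mul_ne_zero (pow_ne_zero _ (hq (Setting.labelSucc i₀) vQ₀ i)) (hc₀ i)
  have hHul : W ∈ (P.frame (Setting.labelSucc i₀) vQ₀).Hul :=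
    ⟨_, (V.hul_iff (Setting.labelSucc i₀) vQ₀ _).2 ⟨_, hctr, rfl⟩, rfl⟩
  -- the one-smul normalisation
  have hone : (1 : ℚ) • W = W := one_smul ℚ W
  -- qLocal in closed form
  have hqLoc : P.qLocal (Setting.labelSucc i₀) vQ₀ =
      ∑ i, V.w (Setting.labelSucc i₀) vQ₀ i * (V.vol (Setting.labelSucc i₀) vQ₀ i).mulLogvol (qc i) :=
    FrameVolumePieces.qLocal_ofFrames lat sig split qData thetaBox qCentre hq hadm hfin hV
      (Setting.labelSucc i₀) vQ₀
  -- the dilate's volume: κ + Nw·qLocal (the Step (v) shape, as an equality)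
  have hWvol : (S.D P.n).logvol (Setting.labelSucc i₀) vQ₀ W =
      (∑ i, V.w (Setting.labelSucc i₀) vQ₀ i *
        (V.vol (Setting.labelSucc i₀) vQ₀ i).mulLogvol (c₀ i)) +
        Nw * ∑ i, V.w (Setting.labelSucc i₀) vQ₀ i *
          (V.vol (Setting.labelSucc i₀) vQ₀ i).mulLogvol (qc i) := by
    have := V.logvol_preimage_hullSet_pow_mul (Setting.labelSucc i₀) vQ₀ hmul qc c₀
      (fun i => hq (Setting.labelSucc i₀) vQ₀ i) hc₀ Nw
    calc (S.D P.n).logvol (Setting.labelSucc i₀) vQ₀ W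
        = V.logvol (Setting.labelSucc i₀) vQ₀ W := hV.logvol_eq _ _ _
      _ = _ := this
  -- assemble `hnum` and `hdeep` for the abstract fork
  refine not_pointwise_of_deep_packet H i₀ vQ₀ hst (1 : ℚ) ?_ ?_
    (w := (Nw : ℝ))
    (κ := ∑ i, V.w (Setting.labelSucc i₀) vQ₀ i *
      (V.vol (Setting.labelSucc i₀) vQ₀ i).mulLogvol (c₀ i)) ?_ ?_
  · rw [hone]
    exact h3
  · rw [hone]
    exact hHul
  · rw [hone]
    refine le_of_eq ?_
    rw [hWvol, ← hqLoc]
    ring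
  · exact hdeep

end Cor312Vol

end IUTFork

end Summit.ABC

end
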